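import Summits.NavierStokesRegularity.FunctionalMining.CrossedShearProfiles
import Literature.Analysis.FunctionSpaces.TorusInverseLaplacianCalculus
import Literature.Analysis.FunctionSpaces.TorusEnstrophyOrthogonality
import HarnessLib

/-!
# FunctionalMining — the reciprocal crossed shear `u = (a(z) sin 2πy, b(z) sin 2πx, 0)` on `T³`: calculus

Search for candidate a priori estimates; no regularity claim. Cell `pub-nsfunc`, prove seat
(gen 10). The no-go witness W11 of SIEVELD §2 on the unit torus: for two `1`-periodic smooth
profiles `A, B` the field `csField A B (x) = (A(x₂) S(x₁), B(x₂) S(x₀), 0)`, `S = sin 2π·`. This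
file: components, smoothness, the table of partial derivatives, `div = 0`, zero mean, the cross
trace `∑ᵢⱼ ∂ᵢ(csField P Q)ⱼ ∂ⱼ(csField A B)ᵢ = 4π² (P B + Q A)(x₂) C(x₀)C(x₁)` (`C = cos 2π·`),
and the Laplacian `Δ(csField A B) = csField (A″ − 4π²A) (B″ − 4π²B)`. Pure calculus of explicit
fields; nothing about Navier–Stokes.
-/

noncomputable section

open MeasureTheory Set Filter Topology Real
open scoped InnerProductSpace ContDiff

namespace Summit.NavierStokesRegularity.FunctionalMining

open Literature.Analysis Literature.Analysis.FunctionSpaces Literature.Analysis.FunctionSpaces.Torus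
open Literature.Analysis.FluidPDE

namespace CrossedShear

local notation "𝕋³" => UnitAddTorus (Fin 3)
local notation "E³" => EuclideanSpace ℝ (Fin 3)

/-! ## 1. Products of one-coordinate functions -/

/-- `S'` on the circle: `S.D.onCircle b = 2π C.onCircle b`. [folklore] -/
theorem sinP_D_onCircle (b : UnitAddCircle) : sinP.D.onCircle b = 2 * π * cosP.onCircle b := by
  obtain ⟨t, rfl⟩ := QuotientAddGroup.mk_surjective b
  rw [ShearComposition.D_onCircle_coe, ShearProfile.onCircle_coe, deriv_sinP]

/-- `C'` on the circle: `C.D.onCircle b = −2π S.onCircle b`. [folklore] -/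
theorem cosP_D_onCircle (b : UnitAddCircle) : cosP.D.onCircle b = -(2 * π * sinP.onCircle b) := by
  obtain ⟨t, rfl⟩ := QuotientAddGroup.mk_surjective b
  rw [ShearComposition.D_onCircle_coe, ShearProfile.onCircle_coe, deriv_cosP]

/-- **Partial derivatives of a product of two one-coordinate functions** `g(x) = P(x_k) Q(x_l)`:
`∂_r g = [r = k] P'(x_k)Q(x_l) + [r = l] P(x_k)Q'(x_l)`. [folklore] -/
theorem partialDeriv_prod₂ (P Q : ShearProfile) (k l r : Fin 3) (x : 𝕋³) :
    Torus.partialDeriv r (fun y : 𝕋³ => P.onCircle (y k) * Q.onCircle (y l)) x =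
      (if r = k then P.D.onCircle (x k) else 0) * Q.onCircle (x l) +
        P.onCircle (x k) * (if r = l then Q.D.onCircle (x l) else 0) := by
  rw [Torus.partialDeriv_mul (isContDiff_onCircle_comp' P k) (isContDiff_onCircle_comp' Q l) r x,
    partialDeriv_onCircle_comp' P k r x, partialDeriv_onCircle_comp' Q l r x]
  ring

/-- `x ↦ P(x_k) Q(x_l)` is smooth. [folklore] -/
theorem isSmooth_prod₂ (P Q : ShearProfile) (k l : Fin 3) :
    IsSmooth (fun y : 𝕋³ => P.onCircle (y k) * Q.onCircle (y l)) :=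
  (Literature.Analysis.FluidPDE.Torus.DEIJ.isSmooth_onCircle_comp k P).mul
    (Literature.Analysis.FluidPDE.Torus.DEIJ.isSmooth_onCircle_comp l Q)

/-! ## 2. The field -/

/-- First component `f₀(x) = A(x₂) S(x₁)`. [ours; bookkeeping] -/
def f0 (A : ShearProfile) (x : 𝕋³) : ℝ := A.onCircle (x 2) * sinP.onCircle (x 1)

/-- Second component `f₁(x) = B(x₂) S(x₀)`. [ours; bookkeeping] -/
def f1 (B : ShearProfile) (x : 𝕋³) : ℝ := B.onCircle (x 2) * sinP.onCircle (x 0)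

/-- **The crossed-shear field** `csField A B (x) = (A(x₂) sin 2πx₁, B(x₂) sin 2πx₀, 0)` on the unit
`T³` (SIEVELD §2, W11, with amplitudes `A = e^{α}`, `B = e^{−α}`). Search for candidate a priori
estimates; no regularity claim. [ours; packaging] -/
def csField (A B : ShearProfile) (x : 𝕋³) : E³ :=
  f0 A x • EuclideanSpace.single 0 (1 : ℝ) + f1 B x • EuclideanSpace.single 1 (1 : ℝ)

variable (A B : ShearProfile)

/-- First coordinate of the field. [ours; bookkeeping] -/
@[simp] theorem csField_apply_zero (x : 𝕋³) : csField A B x 0 = f0 A x := by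
  simp [csField]

/-- Second coordinate of the field. [ours; bookkeeping] -/
@[simp] theorem csField_apply_one (x : 𝕋³) : csField A B x 1 = f1 B x := by
  simp [csField]

/-- Third coordinate of the field (zero). [ours; bookkeeping] -/
@[simp] theorem csField_apply_two (x : 𝕋³) : csField A B x 2 = 0 := by
  simp [csField]

/-- `f₀` is smooth. [folklore] -/
theorem isSmooth_f0 : IsSmooth (f0 A) := isSmooth_prod₂ A sinP 2 1
/-- `f₁` is smooth. [folklore] -/
theorem isSmooth_f1 : IsSmooth (f1 B) := isSmooth_prod₂ B sinP 2 0

/-- The crossed-shear field is smooth. [folklore] -/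
theorem isSmooth_csField : IsSmooth (csField A B) :=
  ((isSmooth_f0 A).smul' (isSmooth_const _)).add ((isSmooth_f1 B).smul' (isSmooth_const _))

/-- The field is `C¹`. [folklore] -/
theorem isContDiff_csField : IsContDiff 1 (csField A B) := (isSmooth_csField A B).isContDiff (by simp)

/-! ## 3. The table of partial derivatives -/

/-- Partial derivatives of `f₀`. [folklore] -/
theorem partialDeriv_f0 (r : Fin 3) (x : 𝕋³) : Torus.partialDeriv r (f0 A) x =
    (if r = 2 then A.D.onCircle (x 2) else 0) * sinP.onCircle (x 1) +
      A.onCircle (x 2) * (if r = 1 then 2 * π * cosP.onCircle (x 1) else 0) := by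
  have h := partialDeriv_prod₂ A sinP 2 1 r x
  simp only [sinP_D_onCircle] at h ⊢
  exact h

/-- Partial derivatives of `f₁`. [folklore] -/
theorem partialDeriv_f1 (r : Fin 3) (x : 𝕋³) : Torus.partialDeriv r (f1 B) x =
    (if r = 2 then B.D.onCircle (x 2) else 0) * sinP.onCircle (x 0) +
      B.onCircle (x 2) * (if r = 0 then 2 * π * cosP.onCircle (x 0) else 0) := by
  have h := partialDeriv_prod₂ B sinP 2 0 r x
  simp only [sinP_D_onCircle] at h ⊢
  exact h

/-- Coordinates of the partial derivatives of the field. [folklore] -/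
theorem partialDeriv_csField_apply (i j : Fin 3) (x : 𝕋³) :
    Torus.partialDeriv i (csField A B) x j =
      if j = 0 then Torus.partialDeriv i (f0 A) x
      else if j = 1 then Torus.partialDeriv i (f1 B) x else 0 := by
  rw [← Torus.partialDeriv_apply_coord (isContDiff_csField A B) i x j]
  fin_cases j
  · simp
  · simp
  · simp [Torus.partialDeriv, Torus.lineDeriv]

/-- `∂₀u = (0, 2πB(x₂)C(x₀), 0)`, `∂₁u = (2πA(x₂)C(x₁), 0, 0)`, `∂₂u = (A'(x₂)S(x₁), B'(x₂)S(x₀), 0)`: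
the nine entries `(∂ᵢu)ⱼ`. [folklore] -/
theorem partialDeriv_csField_table (x : 𝕋³) :
    Torus.partialDeriv 0 (csField A B) x 0 = 0 ∧
    Torus.partialDeriv 0 (csField A B) x 1 = 2 * π * (B.onCircle (x 2) * cosP.onCircle (x 0)) ∧
    Torus.partialDeriv 0 (csField A B) x 2 = 0 ∧
    Torus.partialDeriv 1 (csField A B) x 0 = 2 * π * (A.onCircle (x 2) * cosP.onCircle (x 1)) ∧
    Torus.partialDeriv 1 (csField A B) x 1 = 0 ∧
    Torus.partialDeriv 1 (csField A B) x 2 = 0 ∧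
    Torus.partialDeriv 2 (csField A B) x 0 = A.D.onCircle (x 2) * sinP.onCircle (x 1) ∧
    Torus.partialDeriv 2 (csField A B) x 1 = B.D.onCircle (x 2) * sinP.onCircle (x 0) ∧
    Torus.partialDeriv 2 (csField A B) x 2 = 0 := by
  simp only [partialDeriv_csField_apply, partialDeriv_f0, partialDeriv_f1]
  refine ⟨?_, ?_, ?_, ?_, ?_, ?_, ?_, ?_, ?_⟩ <;> simp <;> ring

/-! ## 4. Divergence-free and zero mean -/

/-- `div (csField A B) = 0`. [folklore] -/
theorem isDivFree_csField : IsDivFree (csField A B) := by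
  intro x
  obtain ⟨h00, -, -, -, h11, -, -, -, h22⟩ := partialDeriv_csField_table A B x
  unfold Torus.divergence
  rw [Fin.sum_univ_three]
  rw [Torus.partialDeriv_apply_coord (isContDiff_csField A B) 0 x 0,
    Torus.partialDeriv_apply_coord (isContDiff_csField A B) 1 x 1,
    Torus.partialDeriv_apply_coord (isContDiff_csField A B) 2 x 2, h00, h11, h22]
  ring

/-- `∫ f₀ = (∫ 1)(∫ S)(∫ A) = 0`. [folklore] -/
theorem integral_f0 : ∫ x, f0 A x = 0 := by
  have h := MeasureTheory.integral_fintype_prod_volume_eq_prod (𝕜 := ℝ)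
    (![fun _ => (1 : ℝ), sinP.onCircle, A.onCircle] : Fin 3 → UnitAddCircle → ℝ)
  have e : (fun x : 𝕋³ => ∏ i, (![fun _ => (1 : ℝ), sinP.onCircle, A.onCircle] : Fin 3 → UnitAddCircle → ℝ) i (x i)) =
      f0 A := by
    funext x
    rw [Fin.prod_univ_three]
    simp [f0, mul_comm]
  rw [e, Fin.prod_univ_three] at h
  rw [h]
  simp [integral_circle_sinP]

/-- `∫ f₁ = 0`. [folklore] -/
theorem integral_f1 : ∫ x, f1 B x = 0 := by
  have h := MeasureTheory.integral_fintype_prod_volume_eq_prod (𝕜 := ℝ)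
    (![sinP.onCircle, fun _ => (1 : ℝ), B.onCircle] : Fin 3 → UnitAddCircle → ℝ)
  have e : (fun x : 𝕋³ => ∏ i, (![sinP.onCircle, fun _ => (1 : ℝ), B.onCircle] : Fin 3 → UnitAddCircle → ℝ) i (x i)) =
      f1 B := by
    funext x
    rw [Fin.prod_univ_three]
    simp [f1, mul_comm]
  rw [e, Fin.prod_univ_three] at h
  rw [h]
  simp [integral_circle_sinP]

/-- The crossed-shear field has zero mean. [folklore] -/
theorem hasZeroMean_csField : HasZeroMean (csField A B) := by
  show ∫ x, csField A B x = 0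
  have i0 : Integrable (fun x => f0 A x • EuclideanSpace.single (0 : Fin 3) (1 : ℝ)) :=
    ((isSmooth_f0 A).continuous.smul continuous_const).integrable_unitAddTorus
  have i1 : Integrable (fun x => f1 B x • EuclideanSpace.single (1 : Fin 3) (1 : ℝ)) :=
    ((isSmooth_f1 B).continuous.smul continuous_const).integrable_unitAddTorus
  unfold csField
  rw [integral_add i0 i1, integral_smul_const, integral_smul_const, integral_f0, integral_f1]
  simp

/-! ## 5. The cross trace -/

/-- **`∑ᵢⱼ ∂ᵢ(csField P Q)ⱼ ∂ⱼ(csField A B)ᵢ = 4π² (P B + Q A)(x₂) C(x₀) C(x₁)`.** [ours; elementary] -/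
theorem crossTrace_csField (P Q : ShearProfile) (x : 𝕋³) :
    ∑ i, ∑ j, Torus.partialDeriv i (csField P Q) x j * Torus.partialDeriv j (csField A B) x i =
      4 * π ^ 2 * (P.onCircle (x 2) * B.onCircle (x 2) + Q.onCircle (x 2) * A.onCircle (x 2)) *
        (cosP.onCircle (x 0) * cosP.onCircle (x 1)) := by
  obtain ⟨p00, p01, p02, p10, p11, p12, p20, p21, p22⟩ := partialDeriv_csField_table P Q x
  obtain ⟨a00, a01, a02, a10, a11, a12, a20, a21, a22⟩ := partialDeriv_csField_table A B x
  simp only [Fin.sum_univ_three, p00, p01, p02, p10, p11, p12, p20, p21, p22,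
    a00, a01, a02, a10, a11, a12, a20, a21, a22]
  ring

/-! ## 6. The Laplacian -/

/-- The profile `A″ − 4π²A`. [ours; bookkeeping] -/
def lapProfile (A : ShearProfile) : ShearProfile where
  toFun := fun t => A.D.D t - 4 * π ^ 2 * A t
  periodic' := fun t => by
    show A.D.D (t + 1) - 4 * π ^ 2 * A (t + 1) = A.D.D t - 4 * π ^ 2 * A t
    rw [A.D.D.periodic t, A.periodic t]
  contDiff' := A.D.D.contDiff.sub (contDiff_const.mul A.contDiff)

/-- Values of `A″ − 4π²A` on the circle. [ours; bookkeeping] -/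
theorem lapProfile_onCircle (A : ShearProfile) (b : UnitAddCircle) :
    (lapProfile A).onCircle b = A.D.D.onCircle b - 4 * π ^ 2 * A.onCircle b := by
  obtain ⟨t, rfl⟩ := QuotientAddGroup.mk_surjective b
  simp only [ShearProfile.onCircle_coe]
  rfl

/-- Function-level first derivatives of `f₀`. [folklore] -/
theorem partialDeriv_f0_fun :
    Torus.partialDeriv 0 (f0 A) = (fun _ => 0) ∧
    Torus.partialDeriv 1 (f0 A) = (fun x : 𝕋³ => 2 * π * (A.onCircle (x 2) * cosP.onCircle (x 1))) ∧
    Torus.partialDeriv 2 (f0 A) = (fun x : 𝕋³ => A.D.onCircle (x 2) * sinP.onCircle (x 1)) := by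
  refine ⟨funext fun x => ?_, funext fun x => ?_, funext fun x => ?_⟩ <;>
    · rw [partialDeriv_f0]; simp; try ring

/-- Function-level first derivatives of `f₁`. [folklore] -/
theorem partialDeriv_f1_fun :
    Torus.partialDeriv 0 (f1 B) = (fun x : 𝕋³ => 2 * π * (B.onCircle (x 2) * cosP.onCircle (x 0))) ∧
    Torus.partialDeriv 1 (f1 B) = (fun _ => 0) ∧
    Torus.partialDeriv 2 (f1 B) = (fun x : 𝕋³ => B.D.onCircle (x 2) * sinP.onCircle (x 0)) := by
  refine ⟨funext fun x => ?_, funext fun x => ?_, funext fun x => ?_⟩ <;>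
    · rw [partialDeriv_f1]; simp; try ring

/-- `Δf₀ = (A″ − 4π²A)(x₂) S(x₁) = f₀[lapProfile A]`. [folklore] -/
theorem laplacian_f0 (x : 𝕋³) : Torus.laplacian (f0 A) x = f0 (lapProfile A) x := by
  obtain ⟨h0, h1, h2⟩ := partialDeriv_f0_fun A
  rw [Torus.laplacian_eq_sum_partialDeriv_partialDeriv (isSmooth_f0 A), Fin.sum_univ_three, h0, h1, h2]
  have e0 : Torus.partialDeriv 0 (fun _ : 𝕋³ => (0 : ℝ)) x = 0 := by
    simp [Torus.partialDeriv, Torus.lineDeriv]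
  have e1 : Torus.partialDeriv 1 (fun y : 𝕋³ => 2 * π * (A.onCircle (y 2) * cosP.onCircle (y 1))) x =
      2 * π * (A.onCircle (x 2) * -(2 * π * sinP.onCircle (x 1))) := by
    have hc : IsContDiff 1 (fun y : 𝕋³ => A.onCircle (y 2) * cosP.onCircle (y 1)) :=
      (isSmooth_prod₂ A cosP 2 1).isContDiff (by simp)
    rw [show (fun y : 𝕋³ => 2 * π * (A.onCircle (y 2) * cosP.onCircle (y 1))) =
      (2 * π) • (fun y : 𝕋³ => A.onCircle (y 2) * cosP.onCircle (y 1)) from by funext y; simp [smul_eq_mul],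
      Torus.partialDeriv_const_smul hc, Pi.smul_apply, smul_eq_mul, partialDeriv_prod₂]
    simp [cosP_D_onCircle]
  have e2 : Torus.partialDeriv 2 (fun y : 𝕋³ => A.D.onCircle (y 2) * sinP.onCircle (y 1)) x =
      A.D.D.onCircle (x 2) * sinP.onCircle (x 1) := by
    rw [partialDeriv_prod₂]; simp
  rw [e0, e1, e2, f0, lapProfile_onCircle]
  ring

/-- `Δf₁ = f₁[lapProfile B]`. [folklore] -/
theorem laplacian_f1 (x : 𝕋³) : Torus.laplacian (f1 B) x = f1 (lapProfile B) x := by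
  obtain ⟨h0, h1, h2⟩ := partialDeriv_f1_fun B
  rw [Torus.laplacian_eq_sum_partialDeriv_partialDeriv (isSmooth_f1 B), Fin.sum_univ_three, h0, h1, h2]
  have e1 : Torus.partialDeriv 1 (fun _ : 𝕋³ => (0 : ℝ)) x = 0 := by
    simp [Torus.partialDeriv, Torus.lineDeriv]
  have e0 : Torus.partialDeriv 0 (fun y : 𝕋³ => 2 * π * (B.onCircle (y 2) * cosP.onCircle (y 0))) x =
      2 * π * (B.onCircle (x 2) * -(2 * π * sinP.onCircle (x 0))) := by
    have hc : IsContDiff 1 (fun y : 𝕋³ => B.onCircle (y 2) * cosP.onCircle (y 0)) :=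
      (isSmooth_prod₂ B cosP 2 0).isContDiff (by simp)
    rw [show (fun y : 𝕋³ => 2 * π * (B.onCircle (y 2) * cosP.onCircle (y 0))) =
      (2 * π) • (fun y : 𝕋³ => B.onCircle (y 2) * cosP.onCircle (y 0)) from by funext y; simp [smul_eq_mul],
      Torus.partialDeriv_const_smul hc, Pi.smul_apply, smul_eq_mul, partialDeriv_prod₂]
    simp [cosP_D_onCircle]
  have e2 : Torus.partialDeriv 2 (fun y : 𝕋³ => B.D.onCircle (y 2) * sinP.onCircle (y 0)) x =
      B.D.D.onCircle (x 2) * sinP.onCircle (x 0) := by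
    rw [partialDeriv_prod₂]; simp
  rw [e0, e1, e2, f1, lapProfile_onCircle]
  ring

/-- **`Δ(csField A B) = csField (A″ − 4π²A) (B″ − 4π²B)`.** [ours; elementary] -/
theorem laplacian_csField : Torus.laplacian (csField A B) = csField (lapProfile A) (lapProfile B) := by
  funext x
  have hsm := isSmooth_csField A B
  have hcoord : ∀ j : Fin 3, Torus.laplacian (csField A B) x j =
      Torus.laplacian (fun y => csField A B y j) x := by
    intro j
    have h := Torus.laplacian_clm_comp_apply hsm (EuclideanSpace.proj j) x
    exact h.symm
  ext j
  rw [hcoord j]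
  fin_cases j
  · have e : (fun y => csField A B y 0) = f0 A := funext fun y => csField_apply_zero A B y
    simp only [Fin.zero_eta, Fin.isValue]
    rw [e, laplacian_f0, csField_apply_zero]
  · have e : (fun y => csField A B y 1) = f1 B := funext fun y => csField_apply_one A B y
    simp only [Fin.mk_one, Fin.isValue]
    rw [e, laplacian_f1, csField_apply_one]
  · have e : (fun y => csField A B y 2) = fun _ => (0 : ℝ) := funext fun y => csField_apply_two A B y
    simp only [Fin.reduceFinMk, Fin.isValue]
    rw [e, csField_apply_two]
    rw [Torus.laplacian_eq_sum_partialDeriv_partialDeriv (isSmooth_const (0 : ℝ))]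
    simp [Torus.partialDeriv, Torus.lineDeriv]

end CrossedShear

end Summit.NavierStokesRegularity.FunctionalMining
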